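import Mathlib

/-!
# BISECTION of centre/half-width boxes — the node step of a branch-and-bound cover (def-free)

Toolkit lemma for the Lean endgame of the `HomFloor` certificate (decomp-a2c hand-1 g19; critic row 769 «cover format: BISECTION TREE
certificate, cover by structural induction»).  Leaves are boxes `|cᵢ − c₀ᵢ| ≤ wᵢ` (the shape consumed by `…HomCentredForm.leaf_sound_box`,
`…HomGram.boxSum_ge_of_gramLeaf`, `…HomGramHcp.boxSumHcp_ge_of_gramLeaf`); a node bisects coordinate `k`: children have centre
`c₀ ± (w k / 2)·e_k` and half-width `w k / 2` in coordinate `k`, unchanged elsewhere.  `mem_left_or_right_of_mem_box` is the covering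
step; `forall_box_of_forall_children` the induction step of the soundness proof of any such tree checker.  DEF-FREE; standard axioms.
`--supports stmt-AtomisticToContinuum-27623`.
-/

namespace Summit.AtomisticToContinuum.Crystallization.Theorems.FrustratedLawDichotomyStrainedPatchHomBisect

/-- One dimension: `|x − a| ≤ w` ⟹ `|x − (a − w/2)| ≤ w/2 ∨ |x − (a + w/2)| ≤ w/2`. [folklore] -/
theorem abs_sub_half_or (x a w : ℝ) (h : |x - a| ≤ w) : |x - (a - w / 2)| ≤ w / 2 ∨ |x - (a + w / 2)| ≤ w / 2 := by
  rw [abs_le] at h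
  rcases le_total x a with hx | hx
  · left; rw [abs_le]; constructor <;> linarith [h.1]
  · right; rw [abs_le]; constructor <;> linarith [h.2]

/-- ★ **NODE STEP**: a point of the box `(c₀, w)` lies in the left child `(c₀[k ↦ c₀ k − w k/2], w[k ↦ w k/2])` or in the right child
`(c₀[k ↦ c₀ k + w k/2], w[k ↦ w k/2])`. [folklore] -/
theorem mem_left_or_right_of_mem_box {κ : Type*} [DecidableEq κ] (c₀ w c : κ → ℝ) (k : κ) (hc : ∀ i, |c i - c₀ i| ≤ w i) :
    (∀ i, |c i - Function.update c₀ k (c₀ k - w k / 2) i| ≤ Function.update w k (w k / 2) i) ∨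
      (∀ i, |c i - Function.update c₀ k (c₀ k + w k / 2) i| ≤ Function.update w k (w k / 2) i) := by
  rcases abs_sub_half_or (c k) (c₀ k) (w k) (hc k) with hk | hk
  · left
    intro i
    by_cases hi : i = k
    · subst hi; simpa using hk
    · simpa [Function.update_of_ne hi] using hc i
  · right
    intro i
    by_cases hi : i = k
    · subst hi; simpa using hk
    · simpa [Function.update_of_ne hi] using hc i

/-- ★ **INDUCTION STEP of a bisection-tree checker's soundness**: if a property holds on both children of the bisection at `k`, it holds
on the parent box. [folklore] -/
theorem forall_box_of_forall_children {κ : Type*} [DecidableEq κ] {P : (κ → ℝ) → Prop} (c₀ w : κ → ℝ) (k : κ)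
    (hL : ∀ c : κ → ℝ, (∀ i, |c i - Function.update c₀ k (c₀ k - w k / 2) i| ≤ Function.update w k (w k / 2) i) → P c)
    (hR : ∀ c : κ → ℝ, (∀ i, |c i - Function.update c₀ k (c₀ k + w k / 2) i| ≤ Function.update w k (w k / 2) i) → P c) :
    ∀ c : κ → ℝ, (∀ i, |c i - c₀ i| ≤ w i) → P c := fun c hc =>
  (mem_left_or_right_of_mem_box c₀ w c k hc).elim (hL c) (hR c)

/-- The children's half-widths stay non-negative. [folklore] -/
theorem update_half_nonneg {κ : Type*} [DecidableEq κ] (w : κ → ℝ) (k : κ) (hw : ∀ i, 0 ≤ w i) (i : κ) :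
    0 ≤ Function.update w k (w k / 2) i := by
  by_cases hi : i = k
  · subst hi; simpa using div_nonneg (hw i) (by norm_num : (0 : ℝ) ≤ 2)
  · simpa [Function.update_of_ne hi] using hw i

/-- **ROOT STEP**: a box given by corner bounds `lo ≤ c ≤ hi` is the centre/half-width box `((lo + hi)/2, (hi − lo)/2)`. [folklore] -/
theorem mem_box_of_mem_Icc {κ : Type*} (lo hi c : κ → ℝ) (hc : ∀ i, lo i ≤ c i ∧ c i ≤ hi i) :
    ∀ i, |c i - (lo i + hi i) / 2| ≤ (hi i - lo i) / 2 := fun i => by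
  rw [abs_le]; constructor <;> linarith [(hc i).1, (hc i).2]

end Summit.AtomisticToContinuum.Crystallization.Theorems.FrustratedLawDichotomyStrainedPatchHomBisect
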